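import Summits.CriticalPhenomena.PercolationContinuityZ3.Theorems.PercNearOneGluingNoHeavyLowerTailThreePartitionRobustFaces

/-!
# THEOREM A, bookkeeping of the section instances along a coordinate (lineage `prim-bnk-2`, generation 25)

Support file (`--supports stmt-CriticalPhenomena-4575`; memo `FROM-prim-bnk-2-g25-ROBUST-MATCHING.md` §2).  No `sorry`, standard axioms.
For the section up-sets `G¹ = {u : insert e u ∈ G} ⊇ G`, `H¹ ⊇ H` along a coordinate `e`: the nestings
`N(G,H¹) ⊆ N(G,H) ⊆ N(G¹,H)` of the source families, `P(H;G,G) ⊆ P(H;G¹,G¹)`, and the identification of the two THREAD target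
sets `P(H;G¹,G) = P(H;G,G) ⊔ X_a`, `P(H;G,G¹) = P(H;G,G) ⊔ X_b`, `P(H;G¹,G¹) = P(H;G,G) ⊔ X_a ⊔ X_b` where `X_a`, `X_b` split the
new targets by the side `σ` of their layer. [this work]
-/

namespace Summit.CriticalPhenomena.PercolationContinuityZ3.Theorems.ThreePartition

open Finset Function
open scoped Classical

noncomputable section

variable {ι : Type*} [Fintype ι]

/-! ## Inclusions between the section instances and the thread target sets -/

section Sections

variable (τ : Set ι) (s' : Finset ι) (e : ι) {G H : Set (Set ι)} (σ : Set ι → Bool)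

/-- `N(G,H¹) ⊆ N(G,H)`: a stronger side test gives fewer sources. [this work] -/
theorem Nfam_mono_H (hH : IsUpperSet H) :
    Nfam τ s' G ((fun u : Set ι => insert e u) ⁻¹' H) ⊆ Nfam τ s' G H := by
  intro ω hω
  rw [mem_Nfam] at hω ⊢
  exact ⟨hω.1, hω.2.1, fun h => hω.2.2 (mem_preimage_insert_of_mem hH e h)⟩

/-- `N(G,H) ⊆ N(G¹,H)`: a weaker layer test gives more sources. [this work] -/
theorem Nfam_mono_G (hG : IsUpperSet G) :
    Nfam τ s' G H ⊆ Nfam τ s' ((fun u : Set ι => insert e u) ⁻¹' G) H := by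
  intro ω hω
  rw [mem_Nfam] at hω ⊢
  exact ⟨hω.1, mem_preimage_insert_of_mem hG e hω.2.1, hω.2.2⟩

/-- `P(H;G,G) ⊆ P(H;Ga,Gb)` whenever `G ⊆ Ga, Gb`. [this work] -/
theorem Pfam_mono {Ga Gb : Set (Set ι)} (ha : G ⊆ Ga) (hb : G ⊆ Gb) :
    Pfam τ s' H G G σ ⊆ Pfam τ s' H Ga Gb σ := by
  intro ω hω
  rw [mem_Pfam] at hω ⊢
  refine ⟨hω.1, hω.2.1, ?_⟩
  have h := hω.2.2
  split_ifs at h ⊢ with hs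
  · exact hb h
  · exact ha h

/-- The thread-`a` target set: `P(H;G¹,G) = P(H;G,G) ∪ {σ = a}-part of (P(H;G¹,G¹) ∖ P(H;G,G))`. [this work] -/
theorem Pfam_thread_a (hG : IsUpperSet G) :
    Pfam τ s' H G G σ ∪ ((Pfam τ s' H ((fun u : Set ι => insert e u) ⁻¹' G) ((fun u : Set ι => insert e u) ⁻¹' G) σ \
        Pfam τ s' H G G σ).filter fun ω => σ (cp τ s' 2 ω) = false) =
      Pfam τ s' H ((fun u : Set ι => insert e u) ⁻¹' G) G σ := by
  ext ω
  simp only [Finset.mem_union, Finset.mem_filter, Finset.mem_sdiff, mem_Pfam]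
  constructor
  · rintro (⟨hf, hc, h⟩ | ⟨⟨⟨hf, hc, h⟩, hn⟩, hs⟩)
    · refine ⟨hf, hc, ?_⟩
      split_ifs at h ⊢ with hs
      · exact h
      · exact mem_preimage_insert_of_mem hG e h
    · refine ⟨hf, hc, ?_⟩
      rw [hs] at h ⊢; simpa using h
  · rintro ⟨hf, hc, h⟩
    by_cases hs : σ (cp τ s' 2 ω) = true
    · rw [hs] at h; left; exact ⟨hf, hc, by rw [hs]; simpa using h⟩
    · simp only [Bool.not_eq_true] at hs
      rw [hs] at h; simp only [Bool.false_eq_true, ↓reduceIte] at h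
      by_cases hG0 : cp τ s' 0 ω ∈ G
      · left; exact ⟨hf, hc, by rw [hs]; simpa using hG0⟩
      · right; refine ⟨⟨⟨hf, hc, by rw [hs]; simpa using h⟩, ?_⟩, hs⟩
        rintro ⟨-, -, h'⟩; rw [hs] at h'; exact hG0 (by simpa using h')

/-- The thread-`b` target set: `P(H;G,G¹) = P(H;G,G) ∪ {σ = b}-part of (P(H;G¹,G¹) ∖ P(H;G,G))`. [this work] -/
theorem Pfam_thread_b (hG : IsUpperSet G) :
    Pfam τ s' H G G σ ∪ ((Pfam τ s' H ((fun u : Set ι => insert e u) ⁻¹' G) ((fun u : Set ι => insert e u) ⁻¹' G) σ \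
        Pfam τ s' H G G σ).filter fun ω => σ (cp τ s' 2 ω) = true) =
      Pfam τ s' H G ((fun u : Set ι => insert e u) ⁻¹' G) σ := by
  ext ω
  simp only [Finset.mem_union, Finset.mem_filter, Finset.mem_sdiff, mem_Pfam]
  constructor
  · rintro (⟨hf, hc, h⟩ | ⟨⟨⟨hf, hc, h⟩, hn⟩, hs⟩)
    · refine ⟨hf, hc, ?_⟩
      split_ifs at h ⊢ with hs
      · exact mem_preimage_insert_of_mem hG e h
      · exact h
    · refine ⟨hf, hc, ?_⟩
      rw [hs] at h ⊢; simpa using h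
  · rintro ⟨hf, hc, h⟩
    by_cases hs : σ (cp τ s' 2 ω) = true
    · rw [hs] at h; simp only [↓reduceIte] at h
      by_cases hG1 : cp τ s' 1 ω ∈ G
      · left; exact ⟨hf, hc, by rw [hs]; simpa using hG1⟩
      · right; refine ⟨⟨⟨hf, hc, by rw [hs]; simpa using h⟩, ?_⟩, hs⟩
        rintro ⟨-, -, h'⟩; rw [hs] at h'; exact hG1 (by simpa using h')
    · simp only [Bool.not_eq_true] at hs
      rw [hs] at h; left; exact ⟨hf, hc, by rw [hs]; simpa using h⟩

/-- Splitting off the core: `N(G¹,H) = N(G,H) ∪ (N(G¹,H) ∖ N(G,H))` and the target side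
`P(H;G¹,G¹) = P(H;G,G) ∪ X_a ∪ X_b`. [this work] -/
theorem Pfam_split (hG : IsUpperSet G) :
    Pfam τ s' H G G σ ∪
      ((Pfam τ s' H ((fun u : Set ι => insert e u) ⁻¹' G) ((fun u : Set ι => insert e u) ⁻¹' G) σ \
        Pfam τ s' H G G σ).filter fun ω => σ (cp τ s' 2 ω) = false) ∪
      ((Pfam τ s' H ((fun u : Set ι => insert e u) ⁻¹' G) ((fun u : Set ι => insert e u) ⁻¹' G) σ \
        Pfam τ s' H G G σ).filter fun ω => σ (cp τ s' 2 ω) = true) =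
    Pfam τ s' H ((fun u : Set ι => insert e u) ⁻¹' G) ((fun u : Set ι => insert e u) ⁻¹' G) σ := by
  rw [Finset.union_assoc]
  have hX : ∀ X : Finset (ι → Fin 3),
      (X.filter fun ω => σ (cp τ s' 2 ω) = false) ∪ (X.filter fun ω => σ (cp τ s' 2 ω) = true) = X := by
    intro X; ext ω
    simp only [Finset.mem_union, Finset.mem_filter]
    constructor
    · rintro (⟨h, -⟩ | ⟨h, -⟩) <;> exact h
    · intro h; cases hb : σ (cp τ s' 2 ω)
      · exact Or.inl ⟨h, rfl⟩
      · exact Or.inr ⟨h, rfl⟩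
  rw [hX]
  exact Finset.union_sdiff_of_subset (Pfam_mono τ s' σ (fun u hu => mem_preimage_insert_of_mem hG e hu)
    (fun u hu => mem_preimage_insert_of_mem hG e hu))

end Sections

end

end Summit.CriticalPhenomena.PercolationContinuityZ3.Theorems.ThreePartition
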